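import Summits.BirchSwinnertonDyer.BirchSwinnertonDyer.Theorems.KimAtThreeD7uTamagawaComponentDescent
import Summits.BirchSwinnertonDyer.Rank1Residual.GaloisImage.PropagatedStructureCartesian
import HarnessLib

/-!
# The TAMAGAWA-DIVISIBLE bad places, XI: [MR04]'s `𝓕_u` is CARTESIAN along `E[p] ↪ E[p^{k+1}]` at a finite
# `w ∤ p` exactly under `Φ_w[p^k] ⊆ p Φ_w` (Büyükboduk 2009 Prop. 2.7 / Lemma 2.6 for `T_pE`, unconditional,
# every reduction type, every `p`)
# (cell `bsd-addord`, seat w2-tamdiv gen 5; route W2 `KimAtThreeKolyvagin`, items 19562 / 19560, «TamDiv∞»,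
# exponent `≥ 2`)

HONEST FRAMING: TOOL theorems (no definition, no named fact, no `sorry`); closes nothing by itself;
nothing is booked; BSD is not proved by any of this.

## What

For `E/ℚ`, a prime `p`, a finite `w ∤ p` and a level `k`, with
`𝓕_u(w)_k = blochKatoSelmerStructure p (tateTorsionDatum W p k) L (Sum.inr w) = im(H¹_ur(ℚ_w, T_pE) → H¹(ℚ_w, E[p^k·p]))`
([MR04] Remark A.5's unramified condition; seat gen 2) and `incl : E[p^0·p] ↪ E[p^k·p]`:

* §1 **`mem_blochKatoSelmerStructure_of_localMap_torsionInclusion_mem`** (core form) and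
  **`…_of_componentQuotient`** (`Φ_w`-form): if `Φ_w[p^k] ⊆ p Φ_w` then
  `incl_* x ∈ 𝓕_u(w)_k ⇒ x ∈ 𝓕_u(w)_0` — the PULL-BACK hypothesis `hFi` of n1011-p15's Kolyvagin-system
  dévissage (`KSDevissage.apply_eq_zero_of_apply_eq_zero_of_devissage`) for the structure `𝓕_{u-ℓ}` at the
  modified place.  For `𝓕_can` this is n1011-p13's `isCartesianAt_propagatedSelmerStructure` (Mazur–Rubin
  Lemma 3.7.1); for `𝓕_u` it FAILS when `0 < v_p(c_w) ≤ k` (the quotient `Φ_w[p^∞] ⊗ ℤ/p^{k+1}` is then not free)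
  — whence the hypothesis.
  PROOF (values at a Frobenius lift `φ`; parts I, II, V, X; no Kummer theory on `E(ℚ_w)`, no duality):
  `incl ∘ ξ = ψ + ∂t` with `ψ|_{I_w} = 0`, `ψ(φ) = (φ−1) r`, `r` core (part II); `Q = p • (r + t)` is `I_w`- and
  `φ`-fixed hence `D_w`-fixed, `p^k • Q = p^{k+1} • r` is core; the hypothesis gives `Q = p•c' + p•γ` (`c'` core,
  `γ` `D_w`-fixed); `e = r + t − c' − γ ∈ E[p]` and `ξ − ∂e` vanishes on `I_w` with `φ`-value
  `(φ−1) c' ∈ core ∩ E[p] = π_1(T_pE^{I_w})` (part I), so `x ∈ 𝓕_u(w)_0` (part V's criterion).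
* §2 **`localMap_red_mem_blochKatoSelmerStructure`**: the PUSH-FORWARD `red_* 𝓕_u(w)_{k'} ⊆ 𝓕_u(w)_k` for any
  equivariant `red : E[p^{k'}·p] → E[p^k·p]` acting as `p^{k'−k}` on points (no hypothesis).

Sequel: `KimAtThreeD7uTamagawaDefectDevissage` (p = 3: `KS(E[3^k·3], 𝓕_{u-ℓ}) = 0` from the exponent-one
defect, part IX, by induction along `0 → E[3] → E[3^{k+1}·3] → E[3^k·3] → 0`).
References: K. Büyükboduk, JNT 129 (2009) §2.4 Lemma 2.6, Prop. 2.7, Cor. 2.8, §3 Remark 2, Thm. 3.1;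
B. Mazur, K. Rubin, Mem. AMS 799 (2004) Lemma 3.7.1, Prop. 6.2.6, App. A Remark A.5; R. Sakamoto, JTNB 36
(2024) Def. 3.5; K. Rubin, *Euler Systems* Lemma 1.3.2, 1.3.5.
-/

noncomputable section

-- the cell's Theorems namespace `Summit.BirchSwinnertonDyer.BirchSwinnertonDyer.…` repeats the summit name by design (D-0017)
set_option linter.dupNamespace false

open CategoryTheory Function Field IsDedekindDomain NumberField
open scoped NumberField Classical ContRepresentation
open Literature.NumberTheory.GaloisRepresentations Literature.NumberTheory.EllipticCurves
open Literature.NumberTheory.GaloisRepresentations.IsNonarchimedeanLocalField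
open Literature.NumberTheory.GaloisRepresentations.DiscreteGaloisModule
open WeierstrassCurve
open Summit.BirchSwinnertonDyer.Rank1Residual.GaloisImage
open Summit.BirchSwinnertonDyer.Rank1Residual.GaloisImage.InertiaDivisible
open Summit.BirchSwinnertonDyer.Rank1Residual.GaloisImage.Derivative.Transverse.Rat
open Summit.BirchSwinnertonDyer.BirchSwinnertonDyer.Theorems.KimAtThreeD7uTamagawaCore
open Summit.BirchSwinnertonDyer.BirchSwinnertonDyer.Theorems.KimAtThreeD7uTamagawaLevel
open Summit.BirchSwinnertonDyer.BirchSwinnertonDyer.Theorems.KimAtThreeD7uTamagawaIndex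
open Summit.BirchSwinnertonDyer.BirchSwinnertonDyer.Theorems.KimAtThreeD7uTamagawaFreePlaces
open Summit.BirchSwinnertonDyer.BirchSwinnertonDyer.Theorems.KimAtThreeD7uBlochKatoCondition
open Summit.BirchSwinnertonDyer.BirchSwinnertonDyer.Theorems.KimAtThreeD7uUnramifiedMembership

namespace Summit.BirchSwinnertonDyer.BirchSwinnertonDyer.Theorems.KimAtThreeD7uTamagawaCartesian

/-! ### §1 The cartesian criterion over `ℚ` -/

section Rational

variable (W : WeierstrassCurve ℚ) [W.IsElliptic] (p : ℕ) [hp : Fact p.Prime] (k : ℕ)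
  (w : HeightOneSpectrum (𝓞 ℚ))

/-- Local notation: `T_pE|_{Γ_{ℚ_w}}`. -/
local notation3 "𝕋" => (GaloisRep.restrictField (HeightOneSpectrum.adicCompletion ℚ w)
  (WeierstrassCurve.tateGaloisRep W p (W.continuous_galoisRepTate_holds p)).toIntRep)
/-- Local notation: `E[p^k · p]|_{Γ_{ℚ_w}}`. -/
local notation3 "𝕄" => (GaloisRep.restrictField (HeightOneSpectrum.adicCompletion ℚ w)
  (W.torsionGaloisModule ((p : ℤ) ^ k * (p : ℤ))))
/-- Local notation: `E[p^0 · p]|_{Γ_{ℚ_w}}` (the level-one module in the cell's level spelling). -/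
local notation3 "𝕄₀" => (GaloisRep.restrictField (HeightOneSpectrum.adicCompletion ℚ w)
  (W.torsionGaloisModule ((p : ℤ) ^ 0 * (p : ℤ))))
/-- Local notation: the restriction `Γ_{ℚ_w} → Γ_ℚ`. -/
local notation3 "θw" => (absGaloisRestrict ℚ (HeightOneSpectrum.adicCompletion ℚ w))

omit [W.IsElliptic] hp in
/-- `p^0 · p ∣ p^k · p` in `ℤ` (the inclusion `E[p] ⊆ E[p^{k+1}]` in the level spelling). [folklore] -/
theorem pow_zero_mul_dvd : ((p : ℤ) ^ 0 * (p : ℤ)) ∣ ((p : ℤ) ^ k * (p : ℤ)) :=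
  ⟨(p : ℤ) ^ k, by ring⟩

omit hp [W.IsElliptic] in
/-- `incl_* [ξ] = [incl ∘ ξ]` for the inclusion `E[p^0 · p] ↪ E[p^k · p]` at the place `Sum.inr w` (the tree's
`localMap_torsionInclusion_oneCocycleClass` in the level-zero spelling). [folklore] -/
theorem localMap_torsionInclusion_oneCocycleClass_zero
    (ξ : contOneCocycles ((W.torsionGaloisModule ((p : ℤ) ^ 0 * (p : ℤ))).toLocal (Sum.inr w)).toTopRep) :
    DiscreteGaloisModule.localMap (W.torsionInclusion (pow_zero_mul_dvd p k)) (Sum.inr w)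
        (oneCocycleClass _ ξ) =
      oneCocycleClass ((W.torsionGaloisModule ((p : ℤ) ^ k * (p : ℤ))).toLocal (Sum.inr w)).toTopRep
        (contOneCocycles.pullback (ContinuousMonoidHom.id _)
        (X := ((W.torsionGaloisModule ((p : ℤ) ^ 0 * (p : ℤ))).toLocal (Sum.inr w)).toTopRep)
        (Y := ((W.torsionGaloisModule ((p : ℤ) ^ k * (p : ℤ))).toLocal (Sum.inr w)).toTopRep)
        (TopRep.ofHom ⟨((W.torsionInclusion (pow_zero_mul_dvd p k)).restrictField
            (Place.Completion (Sum.inr w : Place ℚ))).toContinuousLinearMap,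
          ((W.torsionInclusion (pow_zero_mul_dvd p k)).restrictField
            (Place.Completion (Sum.inr w : Place ℚ))).isIntertwining'⟩) ξ) :=
  galoisCohomology.map_one_oneCocycleClass _ ξ

/-- **The cartesian criterion for [MR04]'s `𝓕_u` along `E[p] ↪ E[p^{k+1}]`** (Büyükboduk 2009 Prop. 2.7 /
Lemma 2.6 for `T_pE`, unconditional, every reduction type, every `p` with `w ∤ p`).  Let `𝔓₀` be the tree's
prime of `ℚ̄` above the finite place `w ∤ p`, `D ⊇ I` its decomposition and inertia groups, and call a point of
`E[p^∞]` a CORE point when it has `I`-fixed `p^j`-th roots for every `j` (parts I–III: the core is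
`E₀(ℚ_w^{nr})[p^∞]`, the `p`-divisible part of `E[p^∞]^{I}`).  HYPOTHESIS `hH` (the elementary-divisor
condition «`Φ_w[p^k] ⊆ p Φ_w`» read on `E(ℚ_w)[p^∞]/E₀(ℚ_w)[p^∞] ≅ Φ_w[p^∞]`, §1): every `D`-fixed `Q ∈ E[p^∞]`
with `p^k • Q` a core point is `c + p • γ` with `c` a core point and `γ` `D`-fixed.  CONCLUSION: a class
`x ∈ H¹(ℚ_w, E[p^0 · p])` whose image under `incl_* : H¹(ℚ_w, E[p]) → H¹(ℚ_w, E[p^k · p])` lies in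
`𝓕_u(w)_k = blochKatoSelmerStructure p (tateTorsionDatum W p k) L (Sum.inr w)` (`= im H¹_ur(ℚ_w, T_pE)`)
already lies in `𝓕_u(w)_0`.  PROOF (values at a Frobenius lift `φ`, parts I, II, V): `incl ∘ ξ = ψ + ∂t` with
`ψ` vanishing on `I_w` and `ψ(φ) = (φ−1) r`, `r` a core point (part II); `Q = p • (r + t)` is `I`- and
`φ`-fixed, hence `D`-fixed, and `p^k • Q = p^{k+1} • r` is a core point; `hH` gives `Q = p • c' + p • γ`;
then `e = r + t − c' − γ ∈ E[p]`, and `ξ − ∂e` vanishes on `I_w` with `φ`-value `(φ−1) c' ∈ core ∩ E[p]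
= π_1(T_pE^{I})` (part I), i.e. `x ∈ 𝓕_u(w)_0` (part V).
[cite: Buyukboduk2009TamagawaDefect, Prop. 2.7 and Lemma 2.6 (§2.4)] [cite: MazurRubin2004, Lemma 3.7.1 and App. A Remark A.5 (p. 81)] -/
theorem mem_blochKatoSelmerStructure_of_localMap_torsionInclusion_mem (hw : ((p : ℕ) : 𝓞 ℚ) ∉ w.asIdeal)
    (L₀ : (tateTorsionDatum W p 0).LocalConditionsAbove p) (L : (tateTorsionDatum W p k).LocalConditionsAbove p)
    (hH : ∀ Q : W.geomPrimaryTorsion p,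
      (∀ d ∈ (adicCompletionPrime ℚ w).decompositionSubgroup (absoluteGaloisGroup ℚ), d • Q = Q) →
      (∀ j : ℕ, ∃ y : W.geomPrimaryTorsion p,
        (∀ i ∈ (adicCompletionPrime ℚ w).inertia (absoluteGaloisGroup ℚ), i • y = y) ∧ p ^ j • y = p ^ k • Q) →
      ∃ c γ : W.geomPrimaryTorsion p,
        (∀ j : ℕ, ∃ y : W.geomPrimaryTorsion p,
          (∀ i ∈ (adicCompletionPrime ℚ w).inertia (absoluteGaloisGroup ℚ), i • y = y) ∧ p ^ j • y = c) ∧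
        (∀ d ∈ (adicCompletionPrime ℚ w).decompositionSubgroup (absoluteGaloisGroup ℚ), d • γ = γ) ∧
        Q = c + p • γ)
    (x : galoisCohomology ((W.torsionGaloisModule ((p : ℤ) ^ 0 * (p : ℤ))).toLocal (Sum.inr w)) 1)
    (hx : localMap (W.torsionInclusion (pow_zero_mul_dvd p k)) (Sum.inr w) x ∈
      blochKatoSelmerStructure p (tateTorsionDatum W p k) L (Sum.inr w)) :
    x ∈ blochKatoSelmerStructure p (tateTorsionDatum W p 0) L₀ (Sum.inr w) := by
  have hpp : p.Prime := hp.out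
  set 𝔓₀ : Ideal (absIntegers (𝓞 ℚ) ℚ) := adicCompletionPrime ℚ w with h𝔓₀def
  set I : Subgroup (absoluteGaloisGroup ℚ) := 𝔓₀.inertia (absoluteGaloisGroup ℚ) with hIdef
  set Dv : Subgroup (absoluteGaloisGroup ℚ) := 𝔓₀.decompositionSubgroup (absoluteGaloisGroup ℚ)
    with hDvdef
  have hIle : I ≤ Dv := Ideal.inertia_le_decompositionSubgroup _ _
  haveI : (absInertia (w.adicCompletion ℚ)).Normal := absInertia_normal_holds _
  have hIeq : I = (absInertia (w.adicCompletion ℚ)).map (θw).toMonoidHom := by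
    rw [hIdef, h𝔓₀def, inertia_adicCompletionPrime_eq_map_absInertia]
  have hθI : ∀ u : absInertia (w.adicCompletion ℚ), θw u ∈ I := fun u => by
    rw [hIeq]; exact Subgroup.mem_map_of_mem _ u.2
  have hθD : ∀ σ : absoluteGaloisGroup (w.adicCompletion ℚ), θw σ ∈ Dv := fun σ => by
    rw [hDvdef, h𝔓₀def, decompositionSubgroup_adicCompletionPrime_eq_range]; exact ⟨σ, rfl⟩
  obtain ⟨φ, hφ⟩ := exists_isFrobPow_holds (F := w.adicCompletion ℚ) 1
  have hφ' : IsArithFrobAt (𝓞 ℚ) (θw φ) 𝔓₀ := isArithFrobAt_absGaloisRestrict_of_isFrobPow_one w hφ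
  have hφD : θw φ ∈ Dv := hφ'.mem_stabilizer
  -- the torsion modules and their embeddings into `E[p^∞]`
  let Tor := W.geomPrimaryTorsion p
  let Mt := geomTorsion W ((p : ℤ) ^ k * (p : ℤ))
  let Mt₀ := geomTorsion W ((p : ℤ) ^ 0 * (p : ℤ))
  let P : Tor → Prop := fun x => ∀ j : ℕ, ∃ y : Tor, (∀ i ∈ I, i • y = y) ∧ p ^ j • y = x
  have hpow : ∀ Q : geomPoints W, Q ∈ geomTorsion W ((p : ℤ) ^ k * (p : ℤ)) → p ^ (k + 1) • Q = 0 :=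
    fun Q hQ => by
      have h := (mem_geomTorsion_pow_mul_iff W p k Q).mp hQ
      rwa [mem_geomTorsion_iff, natCast_zsmul] at h
  have hpow₀ : ∀ Q : geomPoints W, Q ∈ geomTorsion W ((p : ℤ) ^ 0 * (p : ℤ)) → p • Q = 0 :=
    fun Q hQ => by
      have h := (mem_geomTorsion_pow_mul_iff W p 0 Q).mp hQ
      rwa [mem_geomTorsion_iff, natCast_zsmul, zero_add, pow_one] at h
  have hmem₀ : ∀ Q : geomPoints W, p • Q = 0 → Q ∈ geomTorsion W ((p : ℤ) ^ 0 * (p : ℤ)) :=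
    fun Q hQ => by
      rw [mem_geomTorsion_pow_mul_iff, mem_geomTorsion_iff, natCast_zsmul, zero_add, pow_one]; exact hQ
  let ι : Mt → Tor := fun m => ⟨(m : geomPoints W), (AddCommGroup.mem_primaryComponent).mpr ⟨k + 1, hpow _ m.2⟩⟩
  let ι₀ : Mt₀ → Tor := fun m => ⟨(m : geomPoints W), (AddCommGroup.mem_primaryComponent).mpr ⟨1, by
    rw [pow_one]; exact hpow₀ _ m.2⟩⟩
  have hι : ∀ m : Mt, ((ι m : Tor) : geomPoints W) = (m : geomPoints W) := fun _ => rfl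
  have hι₀ : ∀ m : Mt₀, ((ι₀ m : Tor) : geomPoints W) = (m : geomPoints W) := fun _ => rfl
  have hιp : ∀ m : Mt, p ^ (k + 1) • ι m = 0 := fun m =>
    Subtype.ext (by rw [AddSubmonoidClass.coe_nsmul, ZeroMemClass.coe_zero]; exact hpow _ m.2)
  have hι₀p : ∀ m : Mt₀, p • ι₀ m = 0 := fun m =>
    Subtype.ext (by rw [AddSubmonoidClass.coe_nsmul, ZeroMemClass.coe_zero]; exact hpow₀ _ m.2)
  -- Step 1: a representative `ξ` of `x`; `incl_* x = [ψ]` with `ψ|_{I_w} = 0`, `ψ(φ) = π_{k+1}(a)`, `a ∈ T^I`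
  obtain ⟨ξ, rfl⟩ := oneCocycleClass_surjective
    ((W.torsionGaloisModule ((p : ℤ) ^ 0 * (p : ℤ))).toLocal (Sum.inr w)).toTopRep x
  obtain ⟨ψ, hψI, ⟨a, haI, hψa⟩, hψx⟩ :=
    (mem_blochKatoSelmerStructure_inr_iff_exists_cocycle W p k w L hw hφ _).mp hx
  rw [localMap_torsionInclusion_oneCocycleClass_zero] at hψx
  -- `ξ` and the pulled-back cocycle `incl ∘ ξ`, read over `ℚ_w = w.adicCompletion ℚ` (pure defeq transport)
  let ξ₀ : contOneCocycles (DiscreteGaloisModule.toTopRep 𝕄₀) := ξ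
  let ξ₁ : contOneCocycles (DiscreteGaloisModule.toTopRep 𝕄) :=
    contOneCocycles.pullback (ContinuousMonoidHom.id _)
      (X := DiscreteGaloisModule.toTopRep 𝕄₀) (Y := DiscreteGaloisModule.toTopRep 𝕄)
      (TopRep.ofHom ⟨((W.torsionInclusion (pow_zero_mul_dvd p k)).restrictField
          (w.adicCompletion ℚ)).toContinuousLinearMap,
        ((W.torsionInclusion (pow_zero_mul_dvd p k)).restrictField
          (w.adicCompletion ℚ)).isIntertwining'⟩) ξ₀
  have hξ₁ : ∀ g, ((ξ₁.1 g : Mt) : geomPoints W) = ((ξ₀.1 g : Mt₀) : geomPoints W) := fun _ => rfl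
  have hψx' : oneCocycleClass (DiscreteGaloisModule.toTopRep 𝕄) ξ₁ =
      oneCocycleClass (DiscreteGaloisModule.toTopRep 𝕄) ψ := hψx.symm
  obtain ⟨t, ht⟩ := exists_sub_eq_of_oneCocycleClass_eq (DiscreteGaloisModule.toTopRep 𝕄) ξ₁ ψ hψx'
  -- on points: `ξ g − ψ g = θw g • t − t`
  have ht' : ∀ g : absoluteGaloisGroup (w.adicCompletion ℚ),
      ((ξ₀.1 g : Mt₀) : geomPoints W) - ((ψ.1 g : Mt) : geomPoints W) =
        θw g • (t : geomPoints W) - (t : geomPoints W) := fun g => by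
    rw [← hξ₁]
    exact congrArg (fun P : Mt => (P : geomPoints W)) (ht g)
  -- the core point `s = ψ(φ) = π_{k+1}(a)` (part I) and `r` with `(φ − 1) r = s` (part II)
  have haI' : ∀ i ∈ I, i • a = a := by
    intro i hi
    rw [hIeq] at hi
    obtain ⟨u, hu, rfl⟩ := Subgroup.mem_map.mp hi
    exact haI ⟨u, hu⟩
  have hscore : P (ι (ψ.1 φ)) := by
    have e : ι (ψ.1 φ) = ⟨TateModule.proj p (k + 1) a,
        (AddCommGroup.mem_primaryComponent).mpr ⟨k + 1, TateModule.pow_smul_proj (k + 1) a⟩⟩ :=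
      Subtype.ext hψa
    rw [e]
    exact core_proj_of_inertia_smul_eq W p a haI' (k + 1)
  obtain ⟨r, hrc, hr⟩ := exists_core_frob_smul_sub_eq W p hw hφ' (ι (ψ.1 φ)) hscore
  -- Step 2: `Q = p • (r + t)` is `D`-fixed and `p^k • Q` is a core point
  set u : Tor := r + ι t with hudef
  have huI : ∀ i ∈ I, p • (i • u) = p • u := by
    intro i hi
    rw [hIeq] at hi
    obtain ⟨n, hn, rfl⟩ := Subgroup.mem_map.mp hi
    have h1 : (θw n) • r = r := smul_eq_of_core W p hrc (hθI ⟨n, hn⟩)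
    -- `θw n • t − t = ξ n ∈ E[p]`
    have h2 : (θw n) • (ι t) - ι t = ι₀ (ξ₀.1 n) := by
      apply Subtype.ext
      rw [AddSubgroupClass.coe_sub, primaryComponent.coe_smul, hι, hι₀, ← ht' n]
      have h0 : ψ.1 n = 0 := hψI ⟨n, hn⟩
      rw [h0, ZeroMemClass.coe_zero, sub_zero]
    have h3 : p • ((θw n) • (ι t)) = p • ι t := by
      have h := congrArg (fun z => p • z) h2
      simp only [smul_sub, hι₀p] at h
      exact sub_eq_zero.mp h
    change p • ((θw n : absoluteGaloisGroup ℚ) • (r + ι t)) = p • (r + ι t)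
    rw [smul_add, h1, smul_add, smul_add, h3]
  have huφ : p • ((θw φ) • u) = p • u := by
    -- `θw φ • u − u = (θφ • r − r) + (θφ • t − t) = ψ φ + (ξ φ − ψ φ) = ξ φ ∈ E[p]`
    have h2 : (θw φ) • u - u = ι₀ (ξ₀.1 φ) := by
      apply Subtype.ext
      rw [hudef, smul_add, add_sub_add_comm, hr, AddMemClass.coe_add, AddSubgroupClass.coe_sub,
        primaryComponent.coe_smul, hι, hι, hι₀, ← ht' φ]
      abel
    have h := congrArg (fun z => p • z) h2
    simp only [smul_sub, hι₀p] at h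
    exact sub_eq_zero.mp h
  set Q : Tor := p • u with hQdef
  have hQI : ∀ i ∈ I, i • Q = Q := fun i hi => by rw [hQdef, smul_comm, huI i hi]
  have hQφ : (θw φ) • Q = Q := by rw [hQdef, smul_comm, huφ]
  have hQD : ∀ d ∈ Dv, d • Q = Q := fun d hd =>
    smul_eq_of_mem_decompositionSubgroup_of_inertia_of_frob W p w hφ' hQI hQφ hd
  have hQk : P (p ^ k • Q) := by
    have e : p ^ k • Q = p ^ (k + 1) • r := by
      rw [hQdef, ← mul_smul, ← pow_succ, hudef, smul_add, hιp, add_zero]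
    rw [e]
    exact core_nsmul W p hrc (p ^ (k + 1))
  -- Step 3: the hypothesis: `Q = c + p • γ`, `c = p • c'` core, `γ` `D`-fixed; `e = u − c' − γ ∈ E[p]`
  obtain ⟨c, γ, hcc, hγD, hQcγ⟩ := hH Q hQD hQk
  obtain ⟨c', hc'c, hc'⟩ := exists_core_nsmul_eq_of_core W p hcc
  obtain ⟨e, hedef⟩ : ∃ e : Tor, e = u - c' - γ := ⟨_, rfl⟩
  obtain ⟨n, hndef⟩ : ∃ n : Tor, n = c' - r + γ := ⟨_, rfl⟩
  have hpe : p • e = 0 := by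
    rw [hedef, smul_sub, smul_sub, hc', ← hQdef, hQcγ]; abel
  have hemem : (e : geomPoints W) ∈ geomTorsion W ((p : ℤ) ^ 0 * (p : ℤ)) := by
    apply hmem₀
    have h := congrArg (fun z : Tor => (z : geomPoints W)) hpe
    simpa only [AddSubmonoidClass.coe_nsmul, ZeroMemClass.coe_zero] using h
  let e₀ : Mt₀ := ⟨(e : geomPoints W), hemem⟩
  have he₀ : ((e₀ : Mt₀) : geomPoints W) = (e : geomPoints W) := rfl
  -- `n = c' − r + γ` is `I`-fixed and `t = e + n`
  have hnI : ∀ i ∈ I, i • n = n := fun i hi => by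
    rw [hndef, smul_add, smul_sub, smul_eq_of_core W p hc'c hi, smul_eq_of_core W p hrc hi, hγD i (hIle hi)]
  have htn : (t : geomPoints W) = (e : geomPoints W) + (n : geomPoints W) := by
    have h : ι t = e + n := by rw [hedef, hndef, hudef]; abel
    have h' := congrArg (fun z : Tor => (z : geomPoints W)) h
    rwa [AddMemClass.coe_add] at h'
  -- Step 4: the corrected cocycle `ξ' = ξ − ∂e₀`
  have hec : Continuous fun g : absoluteGaloisGroup (w.adicCompletion ℚ) =>
      (DiscreteGaloisModule.toTopRep 𝕄₀).ρ g e₀ := (𝕄₀).continuous_apply_left e₀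
  let δ : contOneCocycles (DiscreteGaloisModule.toTopRep 𝕄₀) := principalCocycle _ e₀ hec
  let ξ' : contOneCocycles (DiscreteGaloisModule.toTopRep 𝕄₀) := ξ₀ - δ
  have hξ'apply : ∀ g, ξ'.1 g = ξ₀.1 g - ((DiscreteGaloisModule.toTopRep 𝕄₀).ρ g e₀ - e₀) := fun g => by
    change (ξ₀.1 - δ.1) g = _
    rw [ContinuousMap.sub_apply, principalCocycle_apply]
  -- values on points: `ξ' g = ψ g + (θ g • n − n)`
  have hξ'val : ∀ g : absoluteGaloisGroup (w.adicCompletion ℚ),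
      ((ξ'.1 g : Mt₀) : geomPoints W) = ((ψ.1 g : Mt) : geomPoints W) +
        ((θw g • n - n : Tor) : geomPoints W) := by
    intro g
    have h1 : ((ξ'.1 g : Mt₀) : geomPoints W) =
        ((ξ₀.1 g : Mt₀) : geomPoints W) - (θw g • (e : geomPoints W) - (e : geomPoints W)) := by
      rw [hξ'apply, AddSubgroupClass.coe_sub, AddSubgroupClass.coe_sub, coe_toTopRep_torsion_ρ_apply, he₀]
    have h2 := ht' g
    rw [htn, smul_add, sub_eq_iff_eq_add] at h2
    have h4 : ((θw g • n - n : Tor) : geomPoints W) = θw g • (n : geomPoints W) - (n : geomPoints W) := by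
      rw [AddSubgroupClass.coe_sub, primaryComponent.coe_smul]
    rw [h1, h4, h2]
    abel
  have hξ'I : ∀ m : absInertia (w.adicCompletion ℚ), ξ'.1 m = 0 := fun m => by
    apply Subtype.ext
    rw [hξ'val, hψI m, hnI _ (hθI m), sub_self, ZeroMemClass.coe_zero, ZeroMemClass.coe_zero,
      ZeroMemClass.coe_zero, add_zero]
  -- `ξ'(φ) = (θφ − 1) c'`, a core point killed by `p`
  have hξ'φ : ((ξ'.1 φ : Mt₀) : geomPoints W) = (((θw φ) • c' - c' : Tor) : geomPoints W) := by
    rw [hξ'val, ← hι (ψ.1 φ), ← hr, ← AddMemClass.coe_add]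
    congr 1
    rw [hndef, smul_add, smul_sub, hγD _ hφD]
    abel
  have hcore' : P ((θw φ) • c' - c') :=
    core_sub W p (core_smul_of_mem_decompositionSubgroup W p hc'c hφD) hc'c
  have hkill : p ^ (0 + 1) • ((θw φ) • c' - c') = 0 := by
    rw [zero_add, pow_one, smul_sub, smul_comm, hc']
    -- `c = Q − p • γ` is `D`-fixed
    have hcD : (θw φ) • c = c := by
      have e1 : c = Q - p • γ := by rw [hQcγ]; abel
      rw [e1, smul_sub, hQφ, smul_comm, hγD _ hφD]
    rw [hcD, sub_self]
  obtain ⟨a', ha'I, ha'⟩ := exists_tate_proj_eq_of_core W p hcore' hkill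
  -- Step 5: conclude by part V's criterion at level `0`
  refine (mem_blochKatoSelmerStructure_inr_iff_exists_cocycle W p 0 w L₀ hw hφ _).mpr
    ⟨ξ', hξ'I, ⟨a', fun n => ?_, ?_⟩, ?_⟩
  · change (θw n) • a' = a'
    exact ha'I _ (hθI n)
  · rw [hξ'φ, ha']
  · change oneCocycleClass _ (ξ₀ - δ) = _
    rw [oneCocycleClass_sub, oneCocycleClass_principalCocycle, sub_zero]
    rfl

/-- **The component-group form** of the cartesian criterion: if `Φ_w[p^k] ⊆ p Φ_w` (`hΦ`, e.g. `p ∤ c_w`, or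
`Φ_w[p^∞]` cyclic with `p^{k+1} ∣ c_w`), then a class of `H¹(ℚ_w, E[p^0 · p])` whose image in
`H¹(ℚ_w, E[p^k · p])` lies in `𝓕_u(w)_k` lies in `𝓕_u(w)_0` (Büyükboduk 2009 Prop. 2.7: «`H¹_𝓕(ℚ_ℓ,T/𝔪ⁿ)/H¹_𝓖(ℚ_ℓ,T/𝔪ⁿ)`
free `⇒` cartesian», with `𝓕 = 𝓕_can`, `𝓖 = 𝓕_{u-ℓ}`, the quotient being `Φ_ℓ[p^∞] ⊗ ℤ/p^{k+1}` by part VII).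
§1 + the core form. [cite: Buyukboduk2009TamagawaDefect, Prop. 2.7 and Remark 2 (§3)] [cite: MazurRubin2004, App. A Remark A.5 (p. 81)] -/
theorem mem_blochKatoSelmerStructure_of_localMap_torsionInclusion_mem_of_componentQuotient
    (hw : ((p : ℕ) : 𝓞 ℚ) ∉ w.asIdeal)
    (L₀ : (tateTorsionDatum W p 0).LocalConditionsAbove p) (L : (tateTorsionDatum W p k).LocalConditionsAbove p)
    (hΦ : ∀ φ : ((W.localMinimalIntegralModel w).baseChange (w.adicCompletion ℚ)).toAffine.Point ⧸
        (W.localMinimalIntegralModel w).nonsingularReductionSubgroup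
          (integers_valuationRing_valuation (w.adicCompletionIntegers ℚ) (w.adicCompletion ℚ)),
      p ^ k • φ = 0 → ∃ ψ : ((W.localMinimalIntegralModel w).baseChange (w.adicCompletion ℚ)).toAffine.Point ⧸
        (W.localMinimalIntegralModel w).nonsingularReductionSubgroup
          (integers_valuationRing_valuation (w.adicCompletionIntegers ℚ) (w.adicCompletion ℚ)),
        p • ψ = φ)
    (x : galoisCohomology ((W.torsionGaloisModule ((p : ℤ) ^ 0 * (p : ℤ))).toLocal (Sum.inr w)) 1)
    (hx : localMap (W.torsionInclusion (pow_zero_mul_dvd p k)) (Sum.inr w) x ∈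
      blochKatoSelmerStructure p (tateTorsionDatum W p k) L (Sum.inr w)) :
    x ∈ blochKatoSelmerStructure p (tateTorsionDatum W p 0) L₀ (Sum.inr w) := by
  have hw' : ((p : ℕ) : 𝓞 ℚ) ∉ w.asIdeal := hw
  exact mem_blochKatoSelmerStructure_of_localMap_torsionInclusion_mem W p k w hw L₀ L
    (fun Q hQD hQk => exists_core_add_smul_of_componentQuotient W p (v := w) (by exact_mod_cast hw') k hΦ Q hQD hQk)
    x hx

/-! ### §2 The push-forward along `red : E[p^{k'} · p] ↠ E[p^k · p]`: `red_* 𝓕_u(w)_{k'} ⊆ 𝓕_u(w)_k` -/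

/-- **`red_* 𝓕_u(w)_{k'} ⊆ 𝓕_u(w)_k`** for any equivariant `red : E[p^{k'} · p] → E[p^k · p]` which is
`x ↦ p^{k'−k} x` on points (the push-forward hypothesis `hFπ` of the dévissage, at the modified place):
`red ∘ π_{k'+1} = π_{k+1}` on crossed homomorphisms `Γ_{ℚ_w} → T_pE`, so the image of an unramified class
stays the image of the same unramified class. [cite: MazurRubin2004, App. A Remark A.5 (p. 81)] [cite: Rubin2011, §3.1 (p. 29)] -/
theorem localMap_red_mem_blochKatoSelmerStructure {k' : ℕ} (hkk : k ≤ k')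
    (red : (W.torsionGaloisModule ((p : ℤ) ^ k' * (p : ℤ))).toContRepresentation →ⁱL
      (W.torsionGaloisModule ((p : ℤ) ^ k * (p : ℤ))).toContRepresentation)
    (hred : ∀ x : geomTorsion W ((p : ℤ) ^ k' * (p : ℤ)),
      ((red x : geomTorsion W ((p : ℤ) ^ k * (p : ℤ))) : geomPoints W) =
        ((p : ℤ) ^ (k' - k)) • (x : geomPoints W))
    (hw : ((p : ℕ) : 𝓞 ℚ) ∉ w.asIdeal)
    (L' : (tateTorsionDatum W p k').LocalConditionsAbove p) (L : (tateTorsionDatum W p k).LocalConditionsAbove p)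
    {y : galoisCohomology ((W.torsionGaloisModule ((p : ℤ) ^ k' * (p : ℤ))).toLocal (Sum.inr w)) 1}
    (hy : y ∈ blochKatoSelmerStructure p (tateTorsionDatum W p k') L' (Sum.inr w)) :
    localMap red (Sum.inr w) y ∈ blochKatoSelmerStructure p (tateTorsionDatum W p k) L (Sum.inr w) := by
  rw [blochKatoSelmerStructure_inr_of_not_mem _ L' hw] at hy
  obtain ⟨z, hzI, rfl⟩ := (mem_finiteSubgroup_tate_iff W p k' w y).mp hy
  obtain ⟨η, rfl⟩ := oneCocycleClass_surjective (tateLocalRep W p (Sum.inr w)).toTopRep z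
  refine mem_blochKatoSelmerStructure_of_exists_tateLocalMap_eq W p k w L hw ⟨_, hzI, ?_⟩
  -- `red_* (π_{k'+1})_* [η] = (π_{k+1})_* [η]`
  symm
  rw [tateLocalMap_oneCocycleClass, tateLocalMap_oneCocycleClass]
  erw [galoisCohomology.map_one_oneCocycleClass]
  congr 1
  apply Subtype.ext
  apply ContinuousMap.ext
  intro σ
  apply Subtype.ext
  show ((red (tateToTorsion W p k' (η.1 σ)) : geomTorsion W ((p : ℤ) ^ k * (p : ℤ))) : geomPoints W) =
    ((tateToTorsion W p k (η.1 σ) : geomTorsion W ((p : ℤ) ^ k * (p : ℤ))) : geomPoints W)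
  rw [hred, coe_tateToTorsion_apply, coe_tateToTorsion_apply, ← Nat.cast_pow, natCast_zsmul,
    show k' + 1 = (k' - k) + (k + 1) by omega]
  exact TateModule.pow_smul_proj_self_add (k' - k) (k + 1) (η.1 σ)

end Rational

end Summit.BirchSwinnertonDyer.BirchSwinnertonDyer.Theorems.KimAtThreeD7uTamagawaCartesian

end
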